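import Mathlib
import HarnessLib
import Literature.Analysis.FluidPDE.AxisymmetricEuler
import Literature.Analysis.FluidPDE.AxisymmetricVorticityTransport
import Literature.Analysis.FluidPDE.AxisymNoSwirlVorticity
import Summits.NavierStokesRegularity.NavierStokesRegularity.Theorems.LocalSineTubeDoorProfileAlignedWindowRigidityAncient
import Summits.NavierStokesRegularity.NavierStokesRegularity.Theorems.PoloidalWindowDoorPoloidalWindowRigidityFlat
import Summits.NavierStokesRegularity.NavierStokesRegularity.Theorems.PoloidalWindowDoorPoloidalWindowRigidityAxisymmetric
import Summits.NavierStokesRegularity.NavierStokesRegularity.Theorems.PoloidalWindowDoorPoloidalWindowRigidityOneSlice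
import Summits.NavierStokesRegularity.NavierStokesRegularity.Theorems.PoloidalWindowDoorPoloidalWindowRigidityLargeScaleEnergyDecayHolds
import Summits.NavierStokesRegularity.NavierStokesRegularity.Theorems.PoloidalWindowDoorPoloidalWindowRigidityClebschSlope

/-!
# Route `PoloidalWindowDoor`, crux `PoloidalWindowRigidity` (K2, stmt-NavierStokesRegularity-19708) — the stratum
# «one velocity slice is axisymmetric about a vertical axis UP TO A CONSTANT DRIFT» is settled, via the ball average of
# an axisymmetric field and the (unconditional) large-scale energy decay of the Type-I mild class

Cell ns-regularity-ideate, seat ns-poloidal-K2-p1 gen 3 (K2 lead; helper landed `--supports` the crux).  Motivation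
(seat memo K2P1-LOCAL-NOTES §10–§12): the jet-level probe of the crux's residue shows generic poloidal Navier–Stokes jets
collapsing onto profiles whose vorticity slice is axisymmetric about a vertical axis that may MOVE in time, the velocity
being symmetric only up to a drift; the transfer of such configurations to the settled strata needs two tools, both
supplied here:

* `setIntegral_apply_eq_zero_of_isAxisymmetric` (and `…_translate`): the integral over a ball centred on the axis of a
  HORIZONTAL component of an axisymmetric vector field vanishes (rotation by `π` about the axis reverses the horizontal
  components and preserves the ball and Lebesgue measure);
* `drift_apply_eq_zero`: if a profile `v` of the route's Type-I class has a slice `v(s)` with `y ↦ v(s)(y + c) − d`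
  axisymmetric (`c, d` constant vectors), then the horizontal part of the drift vanishes, `d₀ = d₁ = 0`: the ball mean of
  `v(s)ᵢ` over `B(c,R)` equals `dᵢ` exactly (first tool), while `dᵢ² ≤ (1/|B_R|)∫_{B_R}|v(s)|² → 0` as `R → ∞` by the
  unconditional LARGE-SCALE ENERGY DECAY of the class (nsreg-p7 g6 `…LargeScaleEnergyDecayHolds.largeScale_meanEnergy_le`);
* `nonflatLiouville_of_axisymmetric_slice_up_to_drift`: hence the slice itself is axisymmetric about the axis through
  `c` (a vertical drift is rotation-invariant) and nsreg-p6's ONE-SLICE theorem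
  `…OneSlice.nonflatLiouville_of_axisymmetric_slice` (KNSS 2009 Thm 5.2, no swirl by poloidality) ends: `v ≡ 0`, the
  apex is not backward-singular.

WHAT THIS IS NOT: not a claim about Navier–Stokes regularity and not the open residue `stub_residueSupercriticalNearPeak`
— one more settled stratum (Galilean-boosted axisymmetric slices) and a reusable symmetry-average lemma for the proposed
line «lrc-jet» (HOME/ns-poloidal-K2-p1/LINE-PROPOSAL-lrc-jet.md, stub L2′). [folklore]
-/

noncomputable section

-- the summit and its single sub-problem share the name (CONVENTIONS §1), as in every Theorems file
set_option linter.dupNamespace false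

namespace Summit.NavierStokesRegularity.NavierStokesRegularity.Theorems.PoloidalWindowDoorPoloidalWindowRigidityAxisymmetricMean

open MeasureTheory Set Function Filter Topology Metric InnerProductSpace
open scoped RealInnerProductSpace InnerProductSpace
open Literature.Analysis Literature.Analysis.FluidPDE
open Summit.NavierStokesRegularity.NavierStokesRegularity.Theorems.LocalSineTubeDoorProfileAlignedWindowRigidityAncient
open Summit.NavierStokesRegularity.NavierStokesRegularity.Theorems.PoloidalWindowDoorPoloidalWindowRigidityFlat
open Summit.NavierStokesRegularity.NavierStokesRegularity.Theorems.PoloidalWindowDoorPoloidalWindowRigidityAxisymmetric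
open Summit.NavierStokesRegularity.NavierStokesRegularity.Theorems.PoloidalWindowDoorPoloidalWindowRigidityOneSlice
open Summit.NavierStokesRegularity.NavierStokesRegularity.Theorems.PoloidalWindowDoorPoloidalWindowRigidityLargeScaleEnergyDecayHolds
open Summit.NavierStokesRegularity.NavierStokesRegularity.Theorems.PoloidalWindowDoorPoloidalWindowRigidityClebschSlope

/-! ### The rotation by `π` about the axis -/

/-- `(R_π x)₀ = −x₀`. [folklore] -/
theorem rotZ_pi_apply_zero (x : EuclideanSpace ℝ (Fin 3)) : rotZ Real.pi x 0 = -x 0 := by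
  simp [Real.cos_pi, Real.sin_pi]

/-- `(R_π x)₁ = −x₁`. [folklore] -/
theorem rotZ_pi_apply_one (x : EuclideanSpace ℝ (Fin 3)) : rotZ Real.pi x 1 = -x 1 := by
  simp [Real.cos_pi, Real.sin_pi]

/-- A horizontal component of `R_π w` is minus that of `w` (`i ≠ 2`). [folklore] -/
theorem rotZ_pi_apply_of_ne_two (x : EuclideanSpace ℝ (Fin 3)) {i : Fin 3} (hi : i ≠ 2) :
    rotZ Real.pi x i = -x i := by
  fin_cases i
  · exact rotZ_pi_apply_zero x
  · exact rotZ_pi_apply_one x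
  · exact absurd rfl hi

/-! ### Ball average of the horizontal part of an axisymmetric field -/

/-- **The integral over a ball centred on the axis of a horizontal component of an axisymmetric vector field vanishes.**
(No integrability hypothesis: a non-integrable component has integral `0` by convention.)  Proof: the rotation `R_π`
about the axis preserves Lebesgue measure and the ball and reverses the horizontal components. [folklore] -/
theorem setIntegral_apply_eq_zero_of_isAxisymmetric {u : EuclideanSpace ℝ (Fin 3) → EuclideanSpace ℝ (Fin 3)}
    (hax : IsAxisymmetric u) (r : ℝ) {i : Fin 3} (hi : i ≠ 2) :
    ∫ x in ball (0 : EuclideanSpace ℝ (Fin 3)) r, u x i = 0 := by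
  set Rot : EuclideanSpace ℝ (Fin 3) ≃ₗᵢ[ℝ] EuclideanSpace ℝ (Fin 3) := rotZLIE Real.pi with hRot
  have hmp : MeasurePreserving Rot volume volume := Rot.measurePreserving
  have hpre : Rot ⁻¹' ball (0 : EuclideanSpace ℝ (Fin 3)) r = ball 0 r := by
    rw [Rot.preimage_ball, map_zero]
  have h := hmp.setIntegral_preimage_emb Rot.toHomeomorph.measurableEmbedding
    (fun y : EuclideanSpace ℝ (Fin 3) => u y i) (ball (0 : EuclideanSpace ℝ (Fin 3)) r)
  rw [hpre] at h
  -- `u (R_π x) i = − u x i`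
  have hneg : ∀ x : EuclideanSpace ℝ (Fin 3), u (Rot x) i = -u x i := fun x => by
    rw [hRot, rotZLIE_apply, hax Real.pi x, rotZ_pi_apply_of_ne_two _ hi]
  simp only [hneg, integral_neg] at h
  linarith

/-- The same about the vertical axis through an arbitrary centre `c`: if `y ↦ u (y + c)` is axisymmetric then the
integral of a horizontal component of `u` over any ball centred at `c` vanishes. [folklore] -/
theorem setIntegral_apply_eq_zero_of_isAxisymmetric_translate
    {u : EuclideanSpace ℝ (Fin 3) → EuclideanSpace ℝ (Fin 3)} (c : EuclideanSpace ℝ (Fin 3))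
    (hax : IsAxisymmetric (fun y => u (y + c))) (r : ℝ) {i : Fin 3} (hi : i ≠ 2) :
    ∫ x in ball c r, u x i = 0 := by
  have hmp : MeasurePreserving (fun y : EuclideanSpace ℝ (Fin 3) => y + c) volume volume :=
    measurePreserving_add_right volume c
  have hpre : (fun y : EuclideanSpace ℝ (Fin 3) => y + c) ⁻¹' ball c r = ball 0 r := by
    ext y; simp [Metric.mem_ball, dist_eq_norm]
  have h := hmp.setIntegral_preimage_emb (measurableEmbedding_addRight c)
    (fun y : EuclideanSpace ℝ (Fin 3) => u y i) (ball c r)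
  rw [hpre] at h
  rw [← h]
  exact setIntegral_apply_eq_zero_of_isAxisymmetric hax r hi

/-! ### A component is dominated by the norm -/

/-- `(x i)² ≤ ‖x‖²` in `ℝ³`. [folklore] -/
theorem sq_apply_le_norm_sq (x : EuclideanSpace ℝ (Fin 3)) (i : Fin 3) : (x i) ^ 2 ≤ ‖x‖ ^ 2 := by
  have h := abs_apply_le_norm₃ x i
  calc (x i) ^ 2 = |x i| ^ 2 := (sq_abs _).symm
    _ ≤ ‖x‖ ^ 2 := pow_le_pow_left₀ (abs_nonneg _) h 2

/-! ### The large-scale mean energy bound tends to zero -/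

/-- The explicit rate of `largeScale_meanEnergy_le` tends to `0` as `R → ∞` (for fixed `t < 0`): each of its three terms
is `O(1/R)` for `R ≥ 1` (`log R ≤ R`). [folklore] -/
theorem tendsto_meanEnergy_rate {C K C₁ C₂ t : ℝ} (ht : t < 0) :
    Tendsto (fun R : ℝ => C ^ 2 / (R ^ 2 * (-t)) + 2 * C₂ * C ^ 2 * Real.log R / R ^ 2 +
        2 * C₁ * (C ^ 3 + 2 * C * (K * C ^ 2)) / (R * Real.sqrt (-t))) atTop (nhds 0) := by
  have hnt : 0 < -t := neg_pos.2 ht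
  have hR2 : Tendsto (fun R : ℝ => R ^ 2) atTop atTop := tendsto_pow_atTop two_ne_zero
  -- term 1
  have h1 : Tendsto (fun R : ℝ => C ^ 2 / (R ^ 2 * (-t))) atTop (nhds 0) := by
    have : Tendsto (fun R : ℝ => R ^ 2 * (-t)) atTop atTop := hR2.atTop_mul_const hnt
    exact tendsto_const_nhds.div_atTop this
  -- term 2: `log R / R² → 0`
  have h2 : Tendsto (fun R : ℝ => 2 * C₂ * C ^ 2 * Real.log R / R ^ 2) atTop (nhds 0) := by
    have hlog : Tendsto (fun R : ℝ => Real.log R / R ^ 2) atTop (nhds 0) := by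
      have h := Real.tendsto_pow_log_div_mul_add_atTop 1 0 1 one_ne_zero
      -- `log R / R → 0`, and `log R / R² = (log R / R) · (1/R)`
      have hlr : Tendsto (fun R : ℝ => Real.log R / R) atTop (nhds 0) := by
        simpa using h
      have hinv : Tendsto (fun R : ℝ => R⁻¹) atTop (nhds 0) := tendsto_inv_atTop_zero
      have hprod := hlr.mul hinv
      rw [mul_zero] at hprod
      refine hprod.congr' ?_
      filter_upwards [eventually_ne_atTop (0 : ℝ)] with R hR
      field_simp
    have := hlog.const_mul (2 * C₂ * C ^ 2)
    rw [mul_zero] at this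
    refine this.congr' (Eventually.of_forall fun R => ?_)
    ring
  -- term 3
  have h3 : Tendsto (fun R : ℝ => 2 * C₁ * (C ^ 3 + 2 * C * (K * C ^ 2)) / (R * Real.sqrt (-t))) atTop (nhds 0) := by
    have : Tendsto (fun R : ℝ => R * Real.sqrt (-t)) atTop atTop :=
      tendsto_id.atTop_mul_const (Real.sqrt_pos.2 hnt)
    exact tendsto_const_nhds.div_atTop this
  have h := (h1.add h2).add h3
  simpa using h

/-! ### The drift of an axisymmetric-up-to-drift slice is vertical -/

variable {C : ℝ} {v : ℝ → EuclideanSpace ℝ (Fin 3) → EuclideanSpace ℝ (Fin 3)}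

/-- **The horizontal drift vanishes.**  Let `v` be a profile of the route's Type-I class and suppose that for some
slice `s < 0` and constant vectors `c, d` the field `y ↦ v(s)(y + c) − d` is axisymmetric about the vertical axis.  Then
`d i = 0` for `i ≠ 2`.  Proof: the ball mean of `v(s)ᵢ` over `B(c,R)` is exactly `dᵢ` (the axisymmetric part averages
to zero, `setIntegral_apply_eq_zero_of_isAxisymmetric`), so `dᵢ² |B_R| ≤ ∫_{B(c,R)} v(s)ᵢ² ≤ ∫_{B(c,R)} |v(s)|²`, which is
`≤ 8 |B_R| ε(R)` with `ε(R) → 0` by the large-scale energy decay of the (translated) class. [folklore] -/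
theorem drift_apply_eq_zero (hrate : HasTypeITimeDecay C v)
    (hcont : ContinuousOn (uncurry v) (Iio (0 : ℝ) ×ˢ univ))
    (hmild : ∀ s t : ℝ, s < t → t < 0 → ∀ x,
      v t x = UnboundedOperators.heatExtension (v s) (t - s) x - oseenDuhamel 1 s v v t x)
    (hdiv : ∀ t < 0, VectorCalculus.IsDivFree (v t)) {s : ℝ} (hs : s < 0)
    (c d : EuclideanSpace ℝ (Fin 3)) (hax : IsAxisymmetric (fun y => v s (y + c) - d))
    {i : Fin 3} (hi : i ≠ 2) : d i = 0 := by
  -- ## the translated profile `w(t, y) = v(t, y + c)` is in the class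
  obtain ⟨hrate', hcont', hmild', hdiv'⟩ := class_translate c hrate hcont hmild hdiv
  set w : ℝ → EuclideanSpace ℝ (Fin 3) → EuclideanSpace ℝ (Fin 3) := fun t y => v t (y + c) with hw
  have hbdd' := bdd_of_hasTypeITimeDecay hrate'
  have hwcont : Continuous (w s) :=
    ((analyticOnNhd_slice hcont' hbdd' hmild' hs).contDiff (n := 0)).continuous
  have hwi : Continuous fun y => w s y i :=
    (PiLp.continuous_apply (p := 2) (β := fun _ : Fin 3 => ℝ) i).comp hwcont
  -- the axisymmetric part `u = w(s) − d`
  set u : EuclideanSpace ℝ (Fin 3) → EuclideanSpace ℝ (Fin 3) := fun y => w s y - d with hu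
  have hax' : IsAxisymmetric u := hax
  have hui : Continuous fun y => u y i :=
    (PiLp.continuous_apply (p := 2) (β := fun _ : Fin 3 => ℝ) i).comp (hwcont.sub continuous_const)
  have hui_eq : ∀ y, u y i = w s y i - d i := fun y => by simp [hu]
  -- uniform bounds
  set M : ℝ := |C| / Real.sqrt (-s) with hM
  have hwM : ∀ y, ‖w s y‖ ≤ M := fun y =>
    (hrate' s hs y).trans (div_le_div_of_nonneg_right (le_abs_self C) (Real.sqrt_nonneg _))
  have hwiM : ∀ y, |w s y i| ≤ M := fun y => (abs_apply_le_norm₃ (w s y) i).trans (hwM y)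
  have huiM : ∀ y, |u y i| ≤ M + ‖d‖ := fun y => by
    rw [hui_eq]
    calc |w s y i - d i| ≤ |w s y i| + |d i| := abs_sub _ _
      _ ≤ M + ‖d‖ := add_le_add (hwiM y) (abs_apply_le_norm₃ d i)
  -- ## the energy rate of the translated class
  obtain ⟨K, C₁, C₂, hK0, hC₁0, hC₂0, hE⟩ := largeScale_meanEnergy_le hrate' hcont' hmild' hdiv'
  set ε : ℝ → ℝ := fun R => C ^ 2 / (R ^ 2 * (-s)) + 2 * C₂ * C ^ 2 * Real.log R / R ^ 2 +
      2 * C₁ * (C ^ 3 + 2 * C * (K * C ^ 2)) / (R * Real.sqrt (-s)) with hε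
  have hεlim : Tendsto ε atTop (nhds 0) := tendsto_meanEnergy_rate hs
  -- ## for every `R ≥ 1`: `(d i)² ≤ 8 ε(R)`
  have hkey : ∀ R : ℝ, 1 ≤ R → (d i) ^ 2 ≤ 8 * ε R := by
    intro R hR
    have hR0 : 0 < R := by linarith
    set B : Set (EuclideanSpace ℝ (Fin 3)) := ball (0 : EuclideanSpace ℝ (Fin 3)) R with hB
    have hBmeas : MeasurableSet B := measurableSet_ball
    have hBfin : volume B ≠ ⊤ := measure_ball_lt_top.ne
    have hVpos : 0 < volume.real B := by
      rw [measureReal_def]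
      exact ENNReal.toReal_pos (measure_ball_pos volume _ hR0).ne' hBfin
    -- integrability on `B` (bounded continuous functions on a set of finite measure)
    have hint_u : IntegrableOn (fun y => u y i) B volume :=
      Measure.integrableOn_of_bounded hBfin hui.aestronglyMeasurable (M := M + ‖d‖)
        (Eventually.of_forall fun y => by rw [Real.norm_eq_abs]; exact huiM y)
    have hint_u2 : IntegrableOn (fun y => (u y i) ^ 2) B volume :=
      Measure.integrableOn_of_bounded hBfin (hui.pow 2).aestronglyMeasurable (M := (M + ‖d‖) ^ 2)
        (Eventually.of_forall fun y => by
          rw [Real.norm_eq_abs, abs_pow, sq_abs]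
          calc (u y i) ^ 2 = |u y i| ^ 2 := (sq_abs _).symm
            _ ≤ (M + ‖d‖) ^ 2 := pow_le_pow_left₀ (abs_nonneg _) (huiM y) 2)
    have hint_w2 : IntegrableOn (fun y => (w s y i) ^ 2) B volume :=
      Measure.integrableOn_of_bounded hBfin (hwi.pow 2).aestronglyMeasurable (M := M ^ 2)
        (Eventually.of_forall fun y => by
          rw [Real.norm_eq_abs, abs_pow, sq_abs]
          calc (w s y i) ^ 2 = |w s y i| ^ 2 := (sq_abs _).symm
            _ ≤ M ^ 2 := pow_le_pow_left₀ (abs_nonneg _) (hwiM y) 2)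
    have hint_n2 : IntegrableOn (fun y => ‖w s y‖ ^ 2) B volume :=
      Measure.integrableOn_of_bounded hBfin (hwcont.norm.pow 2).aestronglyMeasurable (M := M ^ 2)
        (Eventually.of_forall fun y => by
          rw [Real.norm_eq_abs, abs_pow, abs_norm]
          exact pow_le_pow_left₀ (norm_nonneg _) (hwM y) 2)
    -- (a) the axisymmetric part averages to zero
    have hzero : ∫ y in B, u y i = 0 := setIntegral_apply_eq_zero_of_isAxisymmetric hax' R hi
    -- (b) `(dᵢ)² |B| ≤ ∫_B w(s)ᵢ²`  (expand `w(s)ᵢ² = uᵢ² + 2 dᵢ uᵢ + dᵢ²`)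
    have hpt : (fun y => (w s y i) ^ 2) = fun y => ((u y i) ^ 2 + 2 * d i * u y i) + (d i) ^ 2 := by
      funext y; rw [hui_eq]; ring
    have h12 : IntegrableOn (fun y => (u y i) ^ 2 + 2 * d i * u y i) B volume :=
      hint_u2.add (hint_u.const_mul (2 * d i))
    have hconst : IntegrableOn (fun _ : EuclideanSpace ℝ (Fin 3) => (d i) ^ 2) B volume :=
      Measure.integrableOn_of_bounded hBfin aestronglyMeasurable_const (M := (d i) ^ 2)
        (Eventually.of_forall fun y => by rw [Real.norm_eq_abs, abs_of_nonneg (sq_nonneg _)])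
    have hexp : ∫ y in B, (w s y i) ^ 2 = (∫ y in B, (u y i) ^ 2) + (d i) ^ 2 * volume.real B := by
      rw [hpt, integral_add h12 hconst, integral_add hint_u2 (hint_u.const_mul (2 * d i)),
        integral_const_mul, hzero, setIntegral_const, smul_eq_mul]
      ring
    have hsq : (d i) ^ 2 * volume.real B ≤ ∫ y in B, (w s y i) ^ 2 := by
      rw [hexp]
      have : 0 ≤ ∫ y in B, (u y i) ^ 2 := setIntegral_nonneg hBmeas fun y _ => sq_nonneg _
      linarith
    -- (c) `∫_B wᵢ² ≤ ∫_B |w|² ≤ 8 |B| ε(R)`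
    have hcomp : ∫ y in B, (w s y i) ^ 2 ≤ ∫ y in B, ‖w s y‖ ^ 2 :=
      setIntegral_mono_on hint_w2 hint_n2 hBmeas fun y _ => sq_apply_le_norm_sq (w s y) i
    have henergy : ∫ y in B, ‖w s y‖ ^ 2 ≤ 8 * volume.real B * ε R := hE s hs R hR
    have hchain : (d i) ^ 2 * volume.real B ≤ 8 * volume.real B * ε R :=
      (hsq.trans hcomp).trans henergy
    nlinarith
  -- ## let `R → ∞`
  have hle : (d i) ^ 2 ≤ 0 := by
    by_contra hcon
    push Not at hcon
    have h8 : Tendsto (fun R => 8 * ε R) atTop (nhds 0) := by simpa using hεlim.const_mul 8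
    have hev : ∀ᶠ R : ℝ in atTop, 8 * ε R < (d i) ^ 2 := h8.eventually (gt_mem_nhds hcon)
    obtain ⟨R, hR1, hR2⟩ := ((eventually_ge_atTop (1 : ℝ)).and hev).exists
    exact absurd (hkey R hR1) (not_le.2 hR2)
  exact pow_eq_zero_iff two_ne_zero |>.1 (le_antisymm hle (sq_nonneg _))

/-- **The stratum «one slice is axisymmetric about a vertical axis up to a constant drift» is settled.**  If a profile of
the route's Type-I class, poloidal along `e₃`, has a slice `v(s)`, `s < 0`, such that `y ↦ v(s)(y + c) − d` is
axisymmetric for some constant vectors `c, d` (a Galilean-boosted axisymmetric slice about the axis `c + ℝe₃`), then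
the drift is vertical (`drift_apply_eq_zero`), the slice itself is axisymmetric about that axis, and nsreg-p6's
one-slice theorem gives `v ≡ 0`: the apex `(0,0)` is not a backward singular point. -/
theorem nonflatLiouville_of_axisymmetric_slice_up_to_drift (hrate : HasTypeITimeDecay C v)
    (hcont : ContinuousOn (uncurry v) (Iio (0 : ℝ) ×ˢ univ))
    (hmild : ∀ s t : ℝ, s < t → t < 0 → ∀ x,
      v t x = UnboundedOperators.heatExtension (v s) (t - s) x - oseenDuhamel 1 s v v t x)
    (hdiv : ∀ t < 0, VectorCalculus.IsDivFree (v t))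
    (hpol : ∀ s < 0, ∀ y, ⟪curl (v s) y, EuclideanSpace.single 2 1⟫_ℝ = 0)
    {s : ℝ} (hs : s < 0) (c d : EuclideanSpace ℝ (Fin 3)) (hax : IsAxisymmetric (fun y => v s (y + c) - d)) :
    ¬ IsBackwardSingularPoint v 0 := by
  have h0 : d 0 = 0 := drift_apply_eq_zero hrate hcont hmild hdiv hs c d hax (by decide)
  have h1 : d 1 = 0 := drift_apply_eq_zero hrate hcont hmild hdiv hs c d hax (by decide)
  have hax' : IsAxisymmetric (fun y => v s (y + c)) := by
    intro θ y
    have h := hax θ y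
    simp only at h
    have hd : rotZ θ d = d := rotZ_eq_self_of_axis θ h0 h1
    have h2 : rotZ θ (v s (y + c) - d) = rotZ θ (v s (y + c)) - d := by
      rw [← rotZL_apply, map_sub, rotZL_apply, rotZL_apply, hd]
    rw [h2] at h
    exact sub_left_injective h
  exact nonflatLiouville_of_axisymmetric_slice hrate hcont hmild hdiv hpol c hs hax'

end Summit.NavierStokesRegularity.NavierStokesRegularity.Theorems.PoloidalWindowDoorPoloidalWindowRigidityAxisymmetricMean

end
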